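import Literature.MathematicalPhysics.QuantumLattice.HubbardNNNHoppingLocalHamiltonian
import Literature.MathematicalPhysics.QuantumLattice.HubbardNNNHoppingThermodynamicLimit
import Literature.MathematicalPhysics.QuantumLattice.HubbardWindowCertificate
import Literature.MathematicalPhysics.QuantumLattice.HubbardLiebTwoHoppings
import HarnessLib

/-!
# Window ("reduce"-mode) bootstrap certificates for the `t–t'` Hubbard model: one identity in the
# CAR algebra of a finite window bounds the energy per site of EVERY large `t–t'` torus, hence the
# thermodynamic-limit energy density `energyDensityTT'`

Topic `Literature/MathematicalPhysics/QuantumLattice`. The `t–t'` companion of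
`HubbardTorusLocalCertificate.lean` + `HubbardWindowCertificate.lean` (nearest-neighbour model),
requested by the Hubbard-ladder cell (LEAN REQUEST #5, R5.3–R5.4): X. Han's translation-invariant
many-body bootstrap (arXiv:2006.06002 §2–3), read on the periodic box through the tracial sector
ground state, for the `t–t'` Hubbard Hamiltonian `hubbardTorusTT' L t t' U`
(`HubbardNNNHopping.lean`; Xu et al., Science 384 (2024), eq. (1)).

* `groundEnergy_eq_minEnergyOn_szSector_of_su2` — for ANY Hermitian `H` conserving `(N↑, N↓)`
  and commuting with `S^±`, the `2n`-particle ground-state energy is attained in the joint sector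
  `(2n, S^z = 0)` (Lieb 1989, proof of Thm 1: every spin multiplet has a representative there);
  the tree's `groundEnergyAt_eq_minEnergyOn_szSector` is the case `H = hamiltonian G t U`, and
  `groundEnergy_hubbardTorusTT'_eq_minEnergyOn_szSector` the `t–t'` torus.
* `torus_minEnergyOn_div_ge_of_local_certificate` — the GENERIC form of
  `hubbardTorus_groundEnergyAt_div_ge_of_local_certificate`: any Hermitian, sector-preserving,
  translation-invariant `A` on the fermionic torus whose local energy `X` has translates summing
  to `A` obeys `c − Σ‖aₖ‖ + Σᵢ μᵢ (gᵢ/L^d − νᵢ) ≤ minEnergyOn A (szSector (2n) 0) / L^d` given the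
  certificate identity (one proof for `t' = 0` and `t' ≠ 0`, as the request preferred).
* `groundEnergy_hubbardTorusTT'_div_ge_of_window_certificate` — **window certificate ⇒ energy per
  site of every large `t–t'` torus**: an identity in `𝔄_{Λ'}` built from
  `(hubbardTTPrimeFermionInteraction t t' U).meanEnergyObs 1` and `.localHamiltonian Λ'` (inner
  region `Λ` with ALL EIGHT king-move neighbours in `Λ'`, `thicken Λ 1 ⊆ Λ'`) gives
  `c − Σₖ ‖aₖ‖ + (Σ_σ μ_σ)(n/L² − ν) ≤ groundEnergy (hubbardTorusTT' L t t' U) (2n) / L²` for every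
  `L ≥ 3` with `x ↦ x mod L` injective on `thicken Λ' 1`.
* `energyDensityTT'_ge_of_window_certificate` — along `N_L = 2⌊nL²/2⌋` the bound passes to the
  thermodynamic limit: `c − Σₖ ‖aₖ‖ ≤ energyDensityTT' t t' U n`
  (`energyDensityTT'_ge_of_eventually_ge_torus`, HubbardNNNHoppingThermodynamicLimit).

Everything is PROVED; no definition, no named fact. The only non-kernel input of a reduce-mode
`t–t'` certificate is the window identity itself (exact CAR arithmetic).

## References
* X. Han, *Quantum many-body bootstrap*, arXiv:2006.06002 (2020), §2 eq. (2)–(8), §3.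
  [cite: Han2020Bootstrap, §3]
* E. H. Lieb, *Two theorems on the Hubbard model*, PRL 62 (1989) 1201, proof of Theorem 1
  (`S^z = 0` representatives). [cite: LiebPRL1989, proof of Theorem 1]
* O. Bratteli, D. W. Robinson, *Operator Algebras and Quantum Statistical Mechanics II*, §6.2.4.
  [cite: BratteliRobinsonII1997, §6.2.4]
* D. Ruelle, *Statistical Mechanics* (1969), §3.3. [cite: Ruelle1969, §3.3]
* H. Xu et al., Science 384 (2024) eadh7691, eq. (1). [cite: XuEtAl2024, eq. (1)]
-/

noncomputable section

namespace Literature.MathematicalPhysics.QuantumLattice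

open Matrix Finset HubbardWave0 Literature.Probability.LatticeModels
open Literature.MathematicalPhysics.QuantumManyBody.StateRelaxation
open scoped ComplexOrder

/-! ### `SU(2)`: the `2n`-particle ground energy of a spin-symmetric Hamiltonian is attained at `S^z = 0` -/

section SU2

variable {Λ : Type*} [LinearOrder Λ] [Fintype Λ]

/-- **Ground states in the joint sector `(2n, S^z = 0)`** for a Hermitian `H` conserving
`(N↑, N↓)` (`n ≤ |Λ|`): the sector carries an eigenvector of `H` at `minEnergyOn`, which bounds the
Rayleigh quotient on the `(n, n)` sector from below. [cite: LiebPRL1989, proof of Theorem 1] -/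
theorem szSector_groundState_of_preservesSectors {H : Matrix (Finset (Orb Λ)) (Finset (Orb Λ)) ℂ}
    (hH : H.IsHermitian) (hHs : PreservesSectors H) {n : ℕ} (hn : n ≤ Fintype.card Λ) :
    (∃ ψ, IsGroundStateInSector H (2 * n) 0 ψ) ∧
      ∀ φ : Fock (Orb Λ), IsInSector n n φ →
        H.minEnergyOn (szSector (2 * n) 0) * (star φ ⬝ᵥ φ).re ≤ (expect H φ).re := by
  classical
  obtain ⟨α₀, -, hα₀⟩ : ∃ α₀ : Finset Λ, α₀ ⊆ univ ∧ α₀.card = n :=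
    Finset.exists_subset_card_eq (by rwa [Finset.card_univ])
  have hp : ∃ s : Finset (Orb Λ), (upPart s).card = n ∧ (downPart s).card = n :=
    ⟨pairSet α₀ α₀, by rw [upPart_pairSet, hα₀], by rw [downPart_pairSet, hα₀]⟩
  have hinv : ∀ s s' : Finset (Orb Λ), ¬((upPart s).card = n ∧ (downPart s).card = n) →
      ((upPart s').card = n ∧ (downPart s').card = n) → H s s' = 0 := by
    intro s s' hs hs'
    by_contra h
    have := hHs s s' h
    exact hs ⟨this.1.trans hs'.1, this.2.trans hs'.2⟩
  have hK : ∀ v : Fock (Orb Λ), v ∈ szSector (2 * n) (0 : ℝ) ↔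
      ∀ s, ¬((upPart s).card = n ∧ (downPart s).card = n) → v s = 0 :=
    fun v => mem_szSector_two_mul_zero_iff n v
  obtain ⟨⟨v, hv, hv0, hHv⟩, hbd⟩ := Literature.MathematicalPhysics.QuantumLattice.sector_groundState H hH
    (fun s => (upPart s).card = n ∧ (downPart s).card = n) hp hinv (szSector (2 * n) 0) hK
  exact ⟨⟨v, hv, hv0, hHv⟩, fun φ hφ => mul_norm_le_of_unit_bound _ hbd hφ⟩

/-- **The ground-state energy in the `N = 2n` sector equals the ground-state energy in the joint
sector `(2n, S^z = 0)`** for every Hermitian `H` that conserves `(N↑, N↓)` and commutes with the spin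
ladder operators `S^±` (every spin multiplet has a representative at `S^z = 0`: a ground state
has a nonzero sector component `(a, b)`, `a + b = 2n`, which `S⁻` resp. `S⁺` maps injectively, step
by step, to a nonzero eigenvector of the same energy in the `(n, n)` sector). Lieb, PRL 62 (1989)
1201, proof of Theorem 1; Lieb–Wu 2003 §5 ("we are allowed to take `S^z = 0`"). The tree's
`groundEnergyAt_eq_minEnergyOn_szSector` is the case `H = hamiltonian G t U`.
[cite: LiebPRL1989, proof of Theorem 1] -/
theorem groundEnergy_eq_minEnergyOn_szSector_of_su2 {H : Matrix (Finset (Orb Λ)) (Finset (Orb Λ)) ℂ}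
    (hH : H.IsHermitian) (hHs : PreservesSectors H)
    (hcommP : Commute H spinPlus) (hcommM : Commute H Literature.MathematicalPhysics.QuantumLattice.spinMinus)
    {n : ℕ} (hn : n ≤ Fintype.card Λ) :
    groundEnergy H (2 * n) = H.minEnergyOn (szSector (2 * n) 0) := by
  classical
  set E₀ : ℝ := groundEnergy H (2 * n) with hE₀
  set E₁ : ℝ := H.minEnergyOn (szSector (2 * n) 0) with hE₁
  obtain ⟨⟨ψ₁, hψ₁, hψ₁0, -⟩, hb⟩ := szSector_groundState_of_preservesSectors hH hHs hn
  -- `E₀ ≤ E₁`: the sector Rayleigh set is contained in the `N`-particle one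
  have hle : E₀ ≤ E₁ := by
    rw [hE₀, groundEnergy, hE₁, Matrix.minEnergyOn]
    refine csInf_le_csInf (LiebThm1.bddBelow_energySet H (2 * n)) ?_ ?_
    · obtain ⟨c, -, hc1⟩ := exists_smul_unit hψ₁0
      exact ⟨_, c • ψ₁, Submodule.smul_mem _ c hψ₁, hc1, rfl⟩
    · rintro E ⟨φ, hφ, hφ1, rfl⟩
      exact ⟨φ, ((mem_szSector_iff _ _ _).1 hφ).1, hφ1, rfl⟩
  -- a ground state in the `N`-particle sector
  obtain ⟨α₀, -, hα₀⟩ : ∃ α₀ : Finset Λ, α₀ ⊆ univ ∧ α₀.card = n :=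
    Finset.exists_subset_card_eq (by rwa [Finset.card_univ])
  have hp : ∃ s : Finset (Orb Λ), s.card = 2 * n :=
    ⟨pairSet α₀ α₀, by rw [card_pairSet, hα₀, two_mul]⟩
  have hinv : ∀ s s' : Finset (Orb Λ), ¬(s.card = 2 * n) → s'.card = 2 * n → H s s' = 0 := by
    intro s s' hs hs'
    by_contra h
    have := hHs s s' h
    apply hs
    rw [card_eq_upPart_add_downPart, this.1, this.2, ← card_eq_upPart_add_downPart, hs']
  obtain ⟨⟨v, hv, hv0, hHv⟩, -⟩ := Literature.MathematicalPhysics.QuantumLattice.sector_groundState H hH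
    (fun s : Finset (Orb Λ) => s.card = 2 * n) hp hinv (nParticleSubmodule (2 * n)) (fun v => Iff.rfl)
  have hvN : IsNParticle (2 * n) v := hv
  have hE₀v : H *ᵥ v = (E₀ : ℂ) • v := by
    rw [hHv, hE₀, groundEnergy_eq_minEnergyOn H (2 * n) (nParticleSubmodule (2 * n)) fun ψ => Iff.rfl]
  -- `S^±` map eigenvectors to eigenvectors
  have heigP : ∀ w : Fock (Orb Λ), H *ᵥ w = (E₀ : ℂ) • w →
      H *ᵥ (spinPlus *ᵥ w) = (E₀ : ℂ) • (spinPlus *ᵥ w) := by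
    intro w hw
    rw [mulVec_mulVec, hcommP.eq, ← mulVec_mulVec, hw, mulVec_smul]
  have heigM : ∀ w : Fock (Orb Λ), H *ᵥ w = (E₀ : ℂ) • w →
      H *ᵥ (Literature.MathematicalPhysics.QuantumLattice.spinMinus *ᵥ w) =
        (E₀ : ℂ) • (Literature.MathematicalPhysics.QuantumLattice.spinMinus *ᵥ w) := by
    intro w hw
    rw [mulVec_mulVec, hcommM.eq, ← mulVec_mulVec, hw, mulVec_smul]
  -- descent to the `(n, n)` sector with `S⁻` (from `a > b`) and `S⁺` (from `a < b`)
  have hB : ∀ j b : ℕ, ∀ w : Fock (Orb Λ), b + (j + 1) = n → IsInSector (b + 2 * (j + 1)) b w →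
      H *ᵥ w = (E₀ : ℂ) • w → w ≠ 0 →
      ∃ w' : Fock (Orb Λ), IsInSector n n w' ∧ H *ᵥ w' = (E₀ : ℂ) • w' ∧ w' ≠ 0 := by
    intro j
    induction j with
    | zero =>
      intro b w hb hw hHw hw0
      have hw' : IsInSector (b + 1) (b + 1) (Literature.MathematicalPhysics.QuantumLattice.spinMinus *ᵥ w) :=
        LiebThm1.lowersSpin_spinMinus.isInSector_mulVec (by simpa [two_mul, add_assoc] using hw)
      have hn' : b + 1 = n := by omega
      rw [hn'] at hw'
      exact ⟨_, hw', heigM w hHw,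
        fun h0 => hw0 (LiebThm1.eq_zero_of_spinMinus_mulVec_eq_zero (by omega) hw h0)⟩
    | succ j ih =>
      intro b w hb hw hHw hw0
      have e : b + 2 * (j + 1 + 1) = (b + 1 + 2 * (j + 1)) + 1 := by ring
      rw [e] at hw
      have hw' : IsInSector (b + 1 + 2 * (j + 1)) (b + 1)
          (Literature.MathematicalPhysics.QuantumLattice.spinMinus *ᵥ w) :=
        LiebThm1.lowersSpin_spinMinus.isInSector_mulVec hw
      exact ih (b + 1) _ (by omega) hw' (heigM w hHw)
        fun h0 => hw0 (LiebThm1.eq_zero_of_spinMinus_mulVec_eq_zero (by omega) hw h0)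
  have hB' : ∀ j a : ℕ, ∀ w : Fock (Orb Λ), a + (j + 1) = n → IsInSector a (a + 2 * (j + 1)) w →
      H *ᵥ w = (E₀ : ℂ) • w → w ≠ 0 →
      ∃ w' : Fock (Orb Λ), IsInSector n n w' ∧ H *ᵥ w' = (E₀ : ℂ) • w' ∧ w' ≠ 0 := by
    intro j
    induction j with
    | zero =>
      intro a w ha hw hHw hw0
      have hw' : IsInSector (a + 1) (a + 1) (spinPlus *ᵥ w) :=
        LiebThm1.raisesSpin_spinPlus.isInSector_mulVec (by simpa [two_mul, add_assoc] using hw)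
      have hn' : a + 1 = n := by omega
      rw [hn'] at hw'
      exact ⟨_, hw', heigP w hHw,
        fun h0 => hw0 (LiebThm1.eq_zero_of_spinPlus_mulVec_eq_zero (by omega) hw h0)⟩
    | succ j ih =>
      intro a w ha hw hHw hw0
      have e : a + 2 * (j + 1 + 1) = (a + 1 + 2 * (j + 1)) + 1 := by ring
      rw [e] at hw
      have hw' : IsInSector (a + 1) (a + 1 + 2 * (j + 1)) (spinPlus *ᵥ w) :=
        LiebThm1.raisesSpin_spinPlus.isInSector_mulVec hw
      exact ih (a + 1) _ (by omega) hw' (heigP w hHw)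
        fun h0 => hw0 (LiebThm1.eq_zero_of_spinPlus_mulVec_eq_zero (by omega) hw h0)
  -- some sector component of `v` is nonzero; move it to the `(n, n)` sector
  have hcomp : ∀ a b : ℕ, H *ᵥ sectorProj a b v = (E₀ : ℂ) • sectorProj a b v := by
    intro a b
    rw [hHs.mulVec_sectorProj, hE₀v, sectorProj_smul]
  obtain ⟨a, ha, hva⟩ : ∃ a ∈ range (2 * n + 1), sectorProj a (2 * n - a) v ≠ 0 := by
    by_contra h
    simp only [not_exists, not_and, not_not] at h
    exact hv0 ((sum_sectorProj_eq hvN).symm.trans (Finset.sum_eq_zero h))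
  obtain ⟨w, hw, hHw, hw0⟩ : ∃ w : Fock (Orb Λ), IsInSector n n w ∧ H *ᵥ w = (E₀ : ℂ) • w ∧ w ≠ 0 := by
    rw [mem_range] at ha
    rcases lt_trichotomy a n with hlt | rfl | hgt
    · obtain ⟨j, hj⟩ : ∃ j, a + (j + 1) = n := ⟨n - a - 1, by omega⟩
      have e : 2 * n - a = a + 2 * (j + 1) := by omega
      refine hB' j a _ hj ?_ (hcomp _ _) hva
      rw [e]
      exact isInSector_sectorProj _ _ _
    · refine ⟨_, ?_, hcomp a (2 * a - a), hva⟩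
      rw [show 2 * a - a = a by omega]
      exact isInSector_sectorProj _ _ _
    · obtain ⟨j, hj⟩ : ∃ j, (2 * n - a) + (j + 1) = n := ⟨a - n - 1, by omega⟩
      have e : a = (2 * n - a) + 2 * (j + 1) := by omega
      refine hB j (2 * n - a) _ hj ?_ (hcomp _ _) hva
      rw [← e]
      exact isInSector_sectorProj _ _ _
  -- hence `E₁ ≤ E₀`
  have hge : E₁ ≤ E₀ := by
    have h1 := hb w hw
    rw [expect, hHw, dotProduct_smul, smul_eq_mul, Complex.re_ofReal_mul] at h1
    have hpos : 0 < (star w ⬝ᵥ w).re :=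
      (Complex.pos_iff.1 (dotProduct_star_self_pos_iff.2 hw0)).1
    exact le_of_mul_le_mul_right h1 hpos
  exact le_antisymm hle hge

/-- **For `H₂ = hamiltonian X a U + hamiltonian Y b 0` (two hopping graphs) the `2n`-particle ground
energy is attained at `S^z = 0`.** [cite: LiebPRL1989, proof of Theorem 1] -/
theorem groundEnergy_hamiltonian₂_eq_minEnergyOn_szSector (X Y : SimpleGraph Λ) [DecidableRel X.Adj]
    [DecidableRel Y.Adj] (a b U : ℝ) {n : ℕ} (hn : n ≤ Fintype.card Λ) :
    groundEnergy (hamiltonian X a U + hamiltonian Y b 0) (2 * n) =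
      (hamiltonian X a U + hamiltonian Y b 0).minEnergyOn (szSector (2 * n) 0) :=
  groundEnergy_eq_minEnergyOn_szSector_of_su2 (LiebTwoHoppings.hamiltonian₂_isHermitian X Y a b U)
    (LiebTwoHoppings.preservesSectors_hamiltonian₂ X Y a b U)
    (LiebTwoHoppings.hamiltonian₂_commute_spinPlus X Y a b U)
    (LiebTwoHoppings.hamiltonian₂_commute_spinMinus X Y a b U) hn

end SU2

/-! ### The `t–t'` torus: sectors, translations -/

section Torus

variable {d L : ℕ} [NeZero L]

/-- (Local to this file, as in `HubbardTorusLocalCertificate` / `HubbardWindowCertificate`.) Torus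
sites are compared through the linear order, the instance carried by the orbital-generic lemmas.
[folklore] -/
local instance (priority := high) instDecidableEqFermionTorusTT : DecidableEq (FermionTorus d L) :=
  LinearOrder.toDecidableEq

/-- **The `2n`-particle ground energy of the `t–t'` torus is attained at `S^z = 0`** (`n ≤ L²`).
[cite: LiebPRL1989, proof of Theorem 1] -/
theorem groundEnergy_hubbardTorusTT'_eq_minEnergyOn_szSector (L : ℕ) [NeZero L] (t t' U : ℝ) {n : ℕ}
    (hn : n ≤ Fintype.card (FermionTorus 2 L)) :
    groundEnergy (hubbardTorusTT' L t t' U) (2 * n) =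
      (hubbardTorusTT' L t t' U).minEnergyOn (szSector (2 * n) 0) :=
  groundEnergy_hamiltonian₂_eq_minEnergyOn_szSector _ _ t t' U hn

/-- **Translation invariance of the `t–t'` torus Hamiltonian**: `T_v H^{tt'} T_v⁻¹ = H^{tt'}` (both
bond graphs of `(ℤ/Lℤ)²` are translation invariant). [cite: XuEtAl2024, eq. (1)] -/
theorem relabel_translate_hubbardTorusTT' (L : ℕ) [NeZero L] (v : TorusSite 2 L) (t t' U : ℝ) :
    relabel (Orb.translate v) (hubbardTorusTT' L t t' U) = hubbardTorusTT' L t t' U := by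
  have hdiag : relabel (Orb.translate v) (hamiltonian (fermionTorusDiagGraph L) t' 0) =
      hamiltonian (fermionTorusDiagGraph L) t' 0 := by
    rw [Orb.translate]
    refine relabel_hamiltonian (fermionTorusDiagGraph L) (fermionTorusDiagGraph L) _ (fun x y => ?_) t' 0
    rw [fermionTorusDiagGraph_adj, fermionTorusDiagGraph_adj, FermionTorus.toTorusSite_ofTorusEquiv,
      FermionTorus.toTorusSite_ofTorusEquiv, torusDiagGraph_adj_iff, torusDiagGraph_adj_iff, Equiv.coe_addRight]
    refine and_congr (not_congr (add_left_inj v)) (or_congr (exists_congr fun s => ?_) (exists_congr fun s => ?_))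
    · rw [add_right_comm, add_left_inj]
    · rw [add_right_comm, add_left_inj]
  rw [hubbardTorusTT', relabel_add, ← hubbardTorus, relabel_translate_hubbardTorus, hdiag]

/-- `[U_v, H^{tt'}] = 0` for the translation unitaries. [cite: XuEtAl2024, eq. (1)] -/
theorem fockTranslate_commute_hubbardTorusTT' (L : ℕ) [NeZero L] (v : TorusSite 2 L) (t t' U : ℝ) :
    Commute (fockTranslate v).val (hubbardTorusTT' L t t' U) :=
  fockRelabel_commute_of_relabel_eq _ (relabel_translate_hubbardTorusTT' L v t t' U)

/-- The `t–t'` torus Hamiltonian preserves the joint sectors `(N, S^z = M)`. [cite: LiebPRL1989] -/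
theorem mulVec_hubbardTorusTT'_mem_szSector (L : ℕ) (t t' U : ℝ) {N : ℕ} {M : ℝ}
    {ψ : Fock (Orb (FermionTorus 2 L))} (hψ : ψ ∈ szSector N M) :
    hubbardTorusTT' L t t' U *ᵥ ψ ∈ szSector N M :=
  mulVec_mem_szSector_of_commute (hubbardTorusTT'_commute_totalNumber L t t' U)
    (hubbardTorusTT'_commute_spinZ L t t' U) hψ

/-! ### The generic translation-averaged certificate on the fermionic torus -/

/-- **Translation-averaged certificate ⇒ sector ground-state energy per site (generic torus
Hamiltonian).** Let `A` be a Hermitian operator on the Fock space of the fermionic torus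
`(ℤ/Lℤ)^d` that preserves `K = szSector (2n) 0` (`n ≤ L^d`) and commutes with the translation
unitaries `U_v = fockTranslate v`. Suppose the translates of a local energy `X` sum to `A`,
`Σ_v U_v X U_vᴴ = A`, the translates of constraint observables `Dᵢ` sum to Hermitian `Gᵢ` acting
as the real scalars `gᵢ` on `K`, and the torus algebra carries the identity
`X − c·1 − Σᵢ μᵢ (Dᵢ − νᵢ·1) = Σ Λₐᵦ Oₐᴴ O_b + (Σₖ (A Xₖ − Xₖ A) + Σₗ (Uₗ Yₗ Uₗᴴ − Yₗ)
  + Σᵣ (Zᵣ (Qᵣ − qᵣ) + (Qᵣ − qᵣ) Z'ᵣ) + Σⱼ (Cⱼ Wⱼ − Wⱼ Cⱼ)) + (Σₘ dₘ • (Vₘᴴ − Vₘ) + Σₖ aₖ • Mₖ)`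
with `Λ ⪰ 0`, symmetries `Uₗ` / charges `Cⱼ` commuting with `A` and (with their adjoints)
preserving `K`, `Uₗᴴ Uₗ = 1`, Hermitian `Qᵣ = qᵣ` on `K`, real `dₘ`, contractions `Mₖ`. Then
`c − Σₖ ‖aₖ‖ + Σᵢ μᵢ (gᵢ / L^d − νᵢ) ≤ minEnergyOn A K / L^d`. This is the proof of
`hubbardTorus_groundEnergyAt_div_ge_of_local_certificate` (Han 2020 §2–3 in the tracial sector
ground state of the periodic box, Bratteli–Robinson II §6.2.4) with the three uses of
`H = hubbardTorus` (Hermiticity, sector preservation, translation invariance) turned into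
hypotheses, so that `hubbardTorus d L t U` and `hubbardTorusTT' L t t' U` are both instances.
[cite: Han2020Bootstrap, §3] -/
theorem torus_minEnergyOn_div_ge_of_local_certificate
    (A : Matrix (Finset (Orb (FermionTorus d L))) (Finset (Orb (FermionTorus d L))) ℂ)
    (hA : A.IsHermitian) {nh : ℕ} (hn : nh ≤ Fintype.card (FermionTorus d L))
    (hKA : ∀ ψ ∈ (szSector (2 * nh) 0 : Submodule ℂ (Fock (Orb (FermionTorus d L)))),
      A *ᵥ ψ ∈ (szSector (2 * nh) 0 : Submodule ℂ (Fock (Orb (FermionTorus d L)))))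
    (hAT : ∀ v : TorusSite d L, (fockTranslate v).val * A = A * (fockTranslate v).val)
    (X : Matrix (Finset (Orb (FermionTorus d L))) (Finset (Orb (FermionTorus d L))) ℂ)
    (hsum : ∑ v : TorusSite d L, (fockTranslate v).val * X * (fockTranslate v).valᴴ = A)
    {δ' : Type*} (dens : Finset δ') (μ ν g : δ' → ℝ)
    (D G : δ' → Matrix (Finset (Orb (FermionTorus d L))) (Finset (Orb (FermionTorus d L))) ℂ)
    (hD : ∀ i ∈ dens, ∑ v : TorusSite d L, (fockTranslate v).val * D i * (fockTranslate v).valᴴ = G i)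
    (hGh : ∀ i ∈ dens, (G i).IsHermitian)
    (hG : ∀ i ∈ dens, ∀ ψ ∈ (szSector (2 * nh) 0 : Submodule ℂ (Fock (Orb (FermionTorus d L)))),
      G i *ᵥ ψ = ((g i : ℝ) : ℂ) • ψ)
    {m : Type*} [Fintype m] [DecidableEq m] {Λm : Matrix m m ℂ} (hΛ : Λm.PosSemidef)
    (O : m → Matrix (Finset (Orb (FermionTorus d L))) (Finset (Orb (FermionTorus d L))) ℂ)
    {κ : Type*} (s : Finset κ)
    (Xc : κ → Matrix (Finset (Orb (FermionTorus d L))) (Finset (Orb (FermionTorus d L))) ℂ)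
    {ι : Type*} (tt : Finset ι)
    (Us Y : ι → Matrix (Finset (Orb (FermionTorus d L))) (Finset (Orb (FermionTorus d L))) ℂ)
    (hU : ∀ l ∈ tt, Us l * A = A * Us l)
    (hUK : ∀ l ∈ tt, ∀ ψ ∈ (szSector (2 * nh) 0 : Submodule ℂ (Fock (Orb (FermionTorus d L)))),
      Us l *ᵥ ψ ∈ (szSector (2 * nh) 0 : Submodule ℂ (Fock (Orb (FermionTorus d L)))))
    (hUK' : ∀ l ∈ tt, ∀ ψ ∈ (szSector (2 * nh) 0 : Submodule ℂ (Fock (Orb (FermionTorus d L)))),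
      (Us l)ᴴ *ᵥ ψ ∈ (szSector (2 * nh) 0 : Submodule ℂ (Fock (Orb (FermionTorus d L)))))
    (hUU : ∀ l ∈ tt, (Us l)ᴴ * Us l = 1)
    {ρ : Type*} (r : Finset ρ)
    (Q Z Z' : ρ → Matrix (Finset (Orb (FermionTorus d L))) (Finset (Orb (FermionTorus d L))) ℂ)
    (q : ρ → ℝ) (hQh : ∀ i ∈ r, (Q i).IsHermitian)
    (hQ : ∀ i ∈ r, ∀ ψ ∈ (szSector (2 * nh) 0 : Submodule ℂ (Fock (Orb (FermionTorus d L)))),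
      Q i *ᵥ ψ = ((q i : ℝ) : ℂ) • ψ)
    {γ : Type*} (u : Finset γ)
    (C W : γ → Matrix (Finset (Orb (FermionTorus d L))) (Finset (Orb (FermionTorus d L))) ℂ)
    (hC : ∀ j ∈ u, C j * A = A * C j)
    (hCK : ∀ j ∈ u, ∀ ψ ∈ (szSector (2 * nh) 0 : Submodule ℂ (Fock (Orb (FermionTorus d L)))),
      C j *ᵥ ψ ∈ (szSector (2 * nh) 0 : Submodule ℂ (Fock (Orb (FermionTorus d L)))))
    (hCK' : ∀ j ∈ u, ∀ ψ ∈ (szSector (2 * nh) 0 : Submodule ℂ (Fock (Orb (FermionTorus d L)))),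
      (C j)ᴴ *ᵥ ψ ∈ (szSector (2 * nh) 0 : Submodule ℂ (Fock (Orb (FermionTorus d L)))))
    {δ : Type*} (ah : Finset δ) (dc : δ → ℝ)
    (V : δ → Matrix (Finset (Orb (FermionTorus d L))) (Finset (Orb (FermionTorus d L))) ℂ)
    {κ'' : Type*} (w : Finset κ'') (a : κ'' → ℂ)
    (M : κ'' → Matrix (Finset (Orb (FermionTorus d L))) (Finset (Orb (FermionTorus d L))) ℂ)
    (hM : ∀ k ∈ w, (M k).IsContraction) {c : ℝ}
    (hcert : X - (c : ℂ) • (1 : Matrix (Finset (Orb (FermionTorus d L))) (Finset (Orb (FermionTorus d L))) ℂ) -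
        ∑ i ∈ dens, ((μ i : ℝ) : ℂ) • (D i - ((ν i : ℝ) : ℂ) •
          (1 : Matrix (Finset (Orb (FermionTorus d L))) (Finset (Orb (FermionTorus d L))) ℂ)) =
      gramForm Λm O +
        (∑ k ∈ s, (A * Xc k - Xc k * A) +
          ∑ l ∈ tt, (Us l * Y l * (Us l)ᴴ - Y l) +
          ∑ i ∈ r, (Z i * (Q i - ((q i : ℝ) : ℂ) • 1) + (Q i - ((q i : ℝ) : ℂ) • 1) * Z' i) +
          ∑ j ∈ u, (C j * W j - W j * C j)) +
        (∑ m' ∈ ah, ((dc m' : ℝ) : ℂ) • ((V m')ᴴ - V m') + ∑ k ∈ w, a k • M k)) :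
    c - ∑ k ∈ w, ‖a k‖ + ∑ i ∈ dens, μ i * (g i / (L : ℝ) ^ d - ν i) ≤
      A.minEnergyOn (szSector (2 * nh) 0) / (L : ℝ) ^ d := by
  set K : Submodule ℂ (Fock (Orb (FermionTorus d L))) := szSector (2 * nh) 0 with hKdef
  have hK : K ≠ ⊥ := szSector_ne_bot 0 0 hn
  -- the objective with the density constraints folded in
  set X' := X - ∑ i ∈ dens, ((μ i : ℝ) : ℂ) • (D i - ((ν i : ℝ) : ℂ) •
    (1 : Matrix (Finset (Orb (FermionTorus d L))) (Finset (Orb (FermionTorus d L))) ℂ)) with hX'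
  have hcert' : X' - (c : ℂ) • (1 : Matrix (Finset (Orb (FermionTorus d L))) (Finset (Orb (FermionTorus d L))) ℂ) =
      gramForm Λm O +
        (∑ k ∈ s, (A * Xc k - Xc k * A) + ∑ l ∈ tt, (Us l * Y l * (Us l)ᴴ - Y l) +
          ∑ i ∈ r, (Z i * (Q i - ((q i : ℝ) : ℂ) • 1) + (Q i - ((q i : ℝ) : ℂ) • 1) * Z' i) +
          ∑ j ∈ u, (C j * W j - W j * C j)) +
        (∑ m' ∈ ah, ((dc m' : ℝ) : ℂ) • ((V m')ᴴ - V m') + ∑ k ∈ w, a k • M k) := by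
    rw [hX', sub_right_comm]
    exact hcert
  have h := Matrix.re_projState_ge_of_local_certificate hA K hKA hK X' hΛ O s Xc tt Us Y hU hUK hUK'
    hUU r Q Z Z' q hQh hQ u C W hC hCK hCK' ah dc V w a M hM hcert'
  -- evaluation of the objective and of the constraint observables in the tracial state
  set P := A.sectorGroundProj K with hP
  have hPh : P.IsHermitian := sectorGroundProj_isHermitian A K
  have hP2 : P * P = P := sectorGroundProj_mul_self A K
  have hP0 : P ≠ 0 := sectorGroundProj_ne_zero hA K hKA hK
  have hPA : P * A = ((A.minEnergyOn K : ℝ) : ℂ) • P := sectorGroundProj_mul hA K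
  set ω := P.projState with hω
  have hone : ω 1 = 1 := projState_one hPh hP2 hP0
  have hPT : ∀ v : TorusSite d L, P * (fockTranslate v).val = (fockTranslate v).val * P := fun v =>
    sectorGroundProj_commute hA K (hAT v)
      (fun ψ hψ => fockTranslate_mulVec_mem_szSector v hψ)
      (fun ψ hψ => fockTranslate_conjTranspose_mulVec_mem_szSector v hψ)
  have hTT : ∀ v : TorusSite d L, (fockTranslate v).valᴴ * (fockTranslate v).val = 1 :=
    fockTranslate_conjTranspose_mul_self
  have hωX : ω X = ((A.minEnergyOn K : ℝ) : ℂ) / (Fintype.card (TorusSite d L) : ℂ) :=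
    projState_eq_div_of_sum_conj hPh hP2 hP0 hPA (fun v => (fockTranslate v).val) hPT hTT hsum
  have hωD : ∀ i ∈ dens, ω (D i) = ((g i : ℝ) : ℂ) / (Fintype.card (TorusSite d L) : ℂ) := by
    intro i hi
    have hPG : P * G i = ((g i : ℝ) : ℂ) • P := by
      have h0 := sectorGroundProj_mul_sub_smul A K (hGh i hi) (hG i hi)
      rw [Matrix.mul_sub, Matrix.mul_smul, Matrix.mul_one, sub_eq_zero] at h0
      exact h0
    exact projState_eq_div_of_sum_conj hPh hP2 hP0 hPG (fun v => (fockTranslate v).val) hPT hTT (hD i hi)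
  have hωX' : ω X' = ((A.minEnergyOn K : ℝ) : ℂ) / (Fintype.card (TorusSite d L) : ℂ) -
      ∑ i ∈ dens, ((μ i : ℝ) : ℂ) * (((g i : ℝ) : ℂ) / (Fintype.card (TorusSite d L) : ℂ) - ((ν i : ℝ) : ℂ)) := by
    rw [hX', map_sub, map_sum, hωX]
    congr 1
    refine Finset.sum_congr rfl fun i hi => ?_
    rw [map_smul, map_sub, map_smul, hone, hωD i hi, smul_eq_mul, smul_eq_mul, mul_one]
  have hre : (ω X').re = A.minEnergyOn K / (L : ℝ) ^ d - ∑ i ∈ dens, μ i * (g i / (L : ℝ) ^ d - ν i) := by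
    rw [hωX', card_torusSite]
    have e : ((A.minEnergyOn K : ℝ) : ℂ) / ((L ^ d : ℕ) : ℂ) -
        ∑ i ∈ dens, ((μ i : ℝ) : ℂ) * (((g i : ℝ) : ℂ) / ((L ^ d : ℕ) : ℂ) - ((ν i : ℝ) : ℂ)) =
        ((A.minEnergyOn K / (L : ℝ) ^ d - ∑ i ∈ dens, μ i * (g i / (L : ℝ) ^ d - ν i) : ℝ) : ℂ) := by
      push_cast
      rfl
    rw [e, Complex.ofReal_re]
  rw [hre] at h
  linarith

/-! ### The window certificate for the `t–t'` torus -/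

/-- **Window certificate ⇒ energy per site of every large `t–t'` torus.** Fix a window `Λ' ⊆ ℤ²`
containing the unit cube `thicken {0} 1`, an inner region `Λ ⊆ Λ'` with ALL EIGHT king-move
neighbours of every site of `Λ` inside `Λ'` (`thicken Λ 1 ⊆ Λ'`), real `μ_↑, μ_↓, ν`, and suppose the
identity in `𝔄_{Λ'}`
`Γ(incl) E^{tt'}_Φ − c·1 − Σ_σ μ_σ (n_{0σ} − ν·1) = Σ Λₐᵦ Oₐᴴ O_b + (Σₖ (H^{tt'}_{Λ'} Bₖ − Bₖ H^{tt'}_{Λ'})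
   + Σₗ (Γ(incl)(Γ(τ_{vₗ}) Yₗ) − Γ(incl) Yₗ) + Σⱼ bⱼ • wⱼ) + (Σₘ dₘ • (Vₘᴴ − Vₘ) + Σₖ aₖ • vₖ)`
with `E^{tt'}_Φ = (hubbardTTPrimeFermionInteraction t t' U).meanEnergyObs 1`,
`H^{tt'}_{Λ'} = (hubbardTTPrimeFermionInteraction t t' U).localHamiltonian Λ'`, `Λ ⪰ 0`,
`Bₖ = Γ(incl) B⁰ₖ`, `B⁰ₖ, Yₗ ∈ 𝔄_Λ`, translations `vₗ` with `Λ + vₗ ⊆ Λ'`, charged ladder words `wⱼ`,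
real `dₘ`, ladder words `vₖ`. Then for every torus side `L ≥ 3` with `x ↦ x mod L` injective on
`thicken Λ' 1` and every `n ≤ L²`:
`c − Σₖ ‖aₖ‖ + (Σ_σ μ_σ)(n/L² − ν) ≤ groundEnergy (hubbardTorusTT' L t t' U) (2n) / L²`.
Han 2020 §2–3 (translation-invariant bootstrap, `F[[H,O]] = 0`, `F[n_x] = n`, charges) for the
`t–t'` model of Xu et al. (2024) eq. (1), read on the periodic box through the tracial sector ground
state. [cite: Han2020Bootstrap, §3] -/
theorem groundEnergy_hubbardTorusTT'_div_ge_of_window_certificate (t t' U : ℝ) {L : ℕ} [NeZero L] (hL : 3 ≤ L)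
    {nh : ℕ} (hn : nh ≤ Fintype.card (FermionTorus 2 L))
    {Λ Λ' : Finset (Site 2)} (hΛ : Λ ⊆ Λ') (h8 : thicken Λ 1 ⊆ Λ')
    (h0 : thicken ({0} : Finset (Site 2)) 1 ⊆ Λ') (hz : (0 : Site 2) ∈ Λ')
    (hInj : Set.InjOn (Torus.proj (d := 2) L) ↑(thicken Λ' 1))
    (μ : Fin 2 → ℝ) (ν : ℝ)
    {m : Type*} [Fintype m] [DecidableEq m] {Λm : Matrix m m ℂ} (hΛm : Λm.PosSemidef)
    (O : m → FermionOp Λ')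
    {κ : Type*} (s : Finset κ) (B : κ → FermionOp Λ)
    {ι : Type*} (tt : Finset ι) (v : ι → Site 2) (hsh : ∀ l, shiftSet (v l) Λ ⊆ Λ') (Y : ι → FermionOp Λ)
    {γ : Type*} (u : Finset γ) (b : γ → ℂ) (cw : γ → List (Orb (PolySite Λ') × Bool))
    (hcw : ∀ j ∈ u, ladderCharge (cw j) ≠ 0 ∨ ladderSpinCharge (cw j) ≠ 0)
    {δ : Type*} (ah : Finset δ) (dc : δ → ℝ) (V : δ → FermionOp Λ')
    {κ'' : Type*} (w : Finset κ'') (a : κ'' → ℂ) (word : κ'' → List (Orb (PolySite Λ') × Bool)) {c : ℝ}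
    (hcert : fermionEmbed (PolySite.incl h0) ((hubbardTTPrimeFermionInteraction t t' U).meanEnergyObs 1) -
        (c : ℂ) • (1 : FermionOp Λ') -
        ∑ σ : Fin 2, ((μ σ : ℝ) : ℂ) • (nAt 0 hz σ - ((ν : ℝ) : ℂ) • (1 : FermionOp Λ')) =
      gramForm Λm O +
        (∑ k ∈ s, ((hubbardTTPrimeFermionInteraction t t' U).localHamiltonian Λ' * fermionEmbed (PolySite.incl hΛ) (B k) -
            fermionEmbed (PolySite.incl hΛ) (B k) * (hubbardTTPrimeFermionInteraction t t' U).localHamiltonian Λ') +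
          ∑ l ∈ tt, (fermionEmbed (PolySite.incl (hsh l)) (fermionEmbed (PolySite.shiftEmb (v l) Λ) (Y l)) -
            fermionEmbed (PolySite.incl hΛ) (Y l)) +
          ∑ j ∈ u, b j • ladderWord (cw j)) +
        (∑ m' ∈ ah, ((dc m' : ℝ) : ℂ) • ((V m')ᴴ - V m') + ∑ k ∈ w, a k • ladderWord (word k))) :
    c - ∑ k ∈ w, ‖a k‖ + (∑ σ : Fin 2, μ σ) * ((nh : ℝ) / (L : ℝ) ^ 2 - ν) ≤
      groundEnergy (hubbardTorusTT' L t t' U) (2 * nh) / (L : ℝ) ^ 2 := by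
  -- the pull-back homomorphism and its restrictions
  have hInj' : Set.InjOn (Torus.proj (d := 2) L) ↑Λ' := hInj.mono (by exact_mod_cast subset_thicken Λ' 1)
  have hInjΛ : Set.InjOn (Torus.proj (d := 2) L) ↑Λ := hInj'.mono (by exact_mod_cast hΛ)
  have hInj0 : Set.InjOn (Torus.proj (d := 2) L) ↑(thicken ({0} : Finset (Site 2)) 1) :=
    hInj'.mono (by exact_mod_cast h0)
  set Γ' := fermionEmbed (PolySite.toTorusEmb L hInj') with hΓ'
  set ΓΛ := fermionEmbed (PolySite.toTorusEmb L hInjΛ) with hΓΛ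
  set H := hubbardTorusTT' L t t' U with hH
  set EΦ := (hubbardTTPrimeFermionInteraction t t' U).meanEnergyObs 1 with hEΦ
  -- the objective: `Γ' (Γ(incl) E_Φ) = Γ(ι₀) E_Φ`, whose translates sum to `H`
  set X := Γ' (fermionEmbed (PolySite.incl h0) EΦ) with hX
  have hX0 : X = fermionEmbed (PolySite.toTorusEmb L hInj0) EΦ := fermionEmbed_toTorusEmb_incl h0 hInj' EΦ
  have hsum : ∑ v' : TorusSite 2 L, (fockTranslate v').val * X * (fockTranslate v').valᴴ = H := by
    rw [hX0]
    have h := sum_relabel_translate_hubbardTTPrime_meanEnergyObs (L := L) t' t U hL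
    simp_rw [relabel_eq_fockRelabel_conj] at h
    exact h
  -- density observables
  set D : Fin 2 → Matrix (Finset (Orb (FermionTorus 2 L))) (Finset (Orb (FermionTorus 2 L))) ℂ :=
    fun σ => numberOp (FermionTorus.ofTorusSite (0 : TorusSite 2 L)) σ with hD
  set G : Fin 2 → Matrix (Finset (Orb (FermionTorus 2 L))) (Finset (Orb (FermionTorus 2 L))) ℂ :=
    fun σ => ∑ y : FermionTorus 2 L, numberOp y σ with hG
  have hDΓ : ∀ σ, Γ' (nAt 0 hz σ) = D σ := fun σ => fermionEmbed_toTorusEmb_nAt_zero hz hInj' σ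
  have hDsum : ∀ σ ∈ (Finset.univ : Finset (Fin 2)),
      ∑ v' : TorusSite 2 L, (fockTranslate v').val * D σ * (fockTranslate v').valᴴ = G σ :=
    fun σ _ => sum_conj_fockTranslate_numberOp 0 σ
  have hGh : ∀ σ ∈ (Finset.univ : Finset (Fin 2)), (G σ).IsHermitian := fun σ _ => isHermitian_sum_numberOp σ
  have hGs : ∀ σ ∈ (Finset.univ : Finset (Fin 2)),
      ∀ ψ ∈ (szSector (2 * nh) 0 : Submodule ℂ (Fock (Orb (FermionTorus 2 L)))),
        G σ *ᵥ ψ = (((nh : ℝ) : ℝ) : ℂ) • ψ := by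
    intro σ _ ψ hψ
    rw [hG, spinNumber_mulVec_of_mem_szSector σ hψ]
    congr 1
    push_cast
    ring
  -- symmetry (translation) family
  set Us : ι → Matrix (Finset (Orb (FermionTorus 2 L))) (Finset (Orb (FermionTorus 2 L))) ℂ :=
    fun l => (fockTranslate (Torus.proj L (v l))).val with hUs
  set Yt : ι → Matrix (Finset (Orb (FermionTorus 2 L))) (Finset (Orb (FermionTorus 2 L))) ℂ :=
    fun l => ΓΛ (Y l) with hYt
  have hU : ∀ l ∈ tt, Us l * H = H * Us l := fun l _ => (fockTranslate_commute_hubbardTorusTT' L _ t t' U).eq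
  have hUK : ∀ l ∈ tt, ∀ ψ ∈ (szSector (2 * nh) 0 : Submodule ℂ (Fock (Orb (FermionTorus 2 L)))),
      Us l *ᵥ ψ ∈ (szSector (2 * nh) 0 : Submodule ℂ (Fock (Orb (FermionTorus 2 L)))) :=
    fun l _ ψ hψ => fockTranslate_mulVec_mem_szSector _ hψ
  have hUK' : ∀ l ∈ tt, ∀ ψ ∈ (szSector (2 * nh) 0 : Submodule ℂ (Fock (Orb (FermionTorus 2 L)))),
      (Us l)ᴴ *ᵥ ψ ∈ (szSector (2 * nh) 0 : Submodule ℂ (Fock (Orb (FermionTorus 2 L)))) :=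
    fun l _ ψ hψ => fockTranslate_conjTranspose_mulVec_mem_szSector _ hψ
  have hUU : ∀ l ∈ tt, (Us l)ᴴ * Us l = 1 := fun l _ => fockTranslate_conjTranspose_mul_self _
  -- charge family (charged words as commutators with `N̂` / `S^z`)
  set emb : Orb (PolySite Λ') × Bool → Orb (FermionTorus 2 L) × Bool :=
    fun p => (Orb.embMap (PolySite.toTorusEmb L hInj') p.1, p.2) with hemb
  set C : γ → Matrix (Finset (Orb (FermionTorus 2 L))) (Finset (Orb (FermionTorus 2 L))) ℂ :=
    fun j => if ladderCharge ((cw j).map emb) ≠ 0 then totalNumber else HubbardWave0.spinZ with hC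
  set W : γ → Matrix (Finset (Orb (FermionTorus 2 L))) (Finset (Orb (FermionTorus 2 L))) ℂ :=
    fun j => (b j / (if ladderCharge ((cw j).map emb) ≠ 0 then ((ladderCharge ((cw j).map emb) : ℤ) : ℂ)
      else ((ladderSpinCharge ((cw j).map emb) : ℤ) : ℂ) / 2)) • ladderWord ((cw j).map emb) with hW
  have hHN : Commute H totalNumber := hubbardTorusTT'_commute_totalNumber L t t' U
  have hHS : Commute H HubbardWave0.spinZ := hubbardTorusTT'_commute_spinZ L t t' U
  have hC1 : ∀ j ∈ u, C j * H = H * C j := by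
    intro j _
    by_cases hq : ladderCharge ((cw j).map emb) ≠ 0
    · simp only [hC, hq, ne_eq, not_false_eq_true, if_true]; exact hHN.symm.eq
    · simp only [hC, hq, if_false]; exact hHS.symm.eq
  have hCK : ∀ j ∈ u, ∀ ψ ∈ (szSector (2 * nh) 0 : Submodule ℂ (Fock (Orb (FermionTorus 2 L)))),
      C j *ᵥ ψ ∈ (szSector (2 * nh) 0 : Submodule ℂ (Fock (Orb (FermionTorus 2 L)))) := by
    intro j _ ψ hψ
    obtain ⟨hNψ, hSψ⟩ := (mem_szSector_iff _ _ ψ).1 hψ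
    by_cases hq : ladderCharge ((cw j).map emb) ≠ 0
    · simp only [hC, hq, ne_eq, not_false_eq_true, if_true]
      rw [totalNumber_mulVec_of_isNParticle hNψ]
      exact Submodule.smul_mem _ _ hψ
    · simp only [hC, hq, if_false]
      rw [hSψ]
      exact Submodule.smul_mem _ _ hψ
  have hCh : ∀ j, (C j)ᴴ = C j := by
    intro j
    by_cases hq : ladderCharge ((cw j).map emb) ≠ 0
    · simp only [hC, hq, ne_eq, not_false_eq_true, if_true]
      rw [totalNumber_eq_numberDiag_univ]
      exact numberDiag_conjTranspose _
    · simp only [hC, hq, if_false]; exact HubbardWave0.spinZ_isHermitian.eq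
  have hCK' : ∀ j ∈ u, ∀ ψ ∈ (szSector (2 * nh) 0 : Submodule ℂ (Fock (Orb (FermionTorus 2 L)))),
      (C j)ᴴ *ᵥ ψ ∈ (szSector (2 * nh) 0 : Submodule ℂ (Fock (Orb (FermionTorus 2 L)))) :=
    fun j hj ψ hψ => by rw [hCh j]; exact hCK j hj ψ hψ
  have hcharged : ∀ j ∈ u, Γ' (b j • ladderWord (cw j)) = C j * W j - W j * C j := by
    intro j hj
    rw [map_smul, hΓ', fermionEmbed_ladderWord]
    have hl : ladderCharge ((cw j).map emb) ≠ 0 ∨ ladderSpinCharge ((cw j).map emb) ≠ 0 := by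
      rw [hemb, ladderCharge_map_embMap, ladderSpinCharge_map_embMap]; exact hcw j hj
    exact smul_ladderWord_eq_commutator_of_charged (b j) _ hl
  -- residual words
  set Mw : κ'' → Matrix (Finset (Orb (FermionTorus 2 L))) (Finset (Orb (FermionTorus 2 L))) ℂ :=
    fun k => ladderWord ((word k).map emb) with hMw
  have hMc : ∀ k ∈ w, (Mw k).IsContraction := fun k _ => by
    rw [hMw]; dsimp only; rw [ladderWord_eq_prod]; exact isContraction_prod_ladder _
  -- the identity, pulled back into the torus
  have htorus : X - (c : ℂ) • (1 : Matrix (Finset (Orb (FermionTorus 2 L))) (Finset (Orb (FermionTorus 2 L))) ℂ) -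
      ∑ σ ∈ (Finset.univ : Finset (Fin 2)), ((μ σ : ℝ) : ℂ) • (D σ - ((ν : ℝ) : ℂ) •
        (1 : Matrix (Finset (Orb (FermionTorus 2 L))) (Finset (Orb (FermionTorus 2 L))) ℂ)) =
      gramForm Λm (fun i => Γ' (O i)) +
        (∑ k ∈ s, (H * Γ' (fermionEmbed (PolySite.incl hΛ) (B k)) - Γ' (fermionEmbed (PolySite.incl hΛ) (B k)) * H) +
          ∑ l ∈ tt, (Us l * Yt l * (Us l)ᴴ - Yt l) +
          ∑ i ∈ (∅ : Finset (Fin 0)), ((0 : Matrix _ _ ℂ) * ((0 : Matrix _ _ ℂ) - (((0 : ℝ) : ℝ) : ℂ) • 1) +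
            ((0 : Matrix _ _ ℂ) - (((0 : ℝ) : ℝ) : ℂ) • 1) * (0 : Matrix _ _ ℂ)) +
          ∑ j ∈ u, (C j * W j - W j * C j)) +
        (∑ m' ∈ ah, ((dc m' : ℝ) : ℂ) • ((Γ' (V m'))ᴴ - Γ' (V m')) + ∑ k ∈ w, a k • Mw k) := by
    have key := congrArg Γ' hcert
    -- left-hand side
    rw [map_sub, map_sub, map_smul, map_one, map_sum] at key
    have hlhs : ∑ σ : Fin 2, Γ' (((μ σ : ℝ) : ℂ) • (nAt 0 hz σ - ((ν : ℝ) : ℂ) • (1 : FermionOp Λ'))) =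
        ∑ σ ∈ (Finset.univ : Finset (Fin 2)), ((μ σ : ℝ) : ℂ) • (D σ - ((ν : ℝ) : ℂ) •
          (1 : Matrix (Finset (Orb (FermionTorus 2 L))) (Finset (Orb (FermionTorus 2 L))) ℂ)) :=
      Finset.sum_congr rfl fun σ _ => by rw [map_smul, map_sub, map_smul, map_one, hDΓ]
    rw [hlhs] at key
    -- right-hand side, family by family
    have h1 : Γ' (∑ k ∈ s, ((hubbardTTPrimeFermionInteraction t t' U).localHamiltonian Λ' * fermionEmbed (PolySite.incl hΛ) (B k) -
        fermionEmbed (PolySite.incl hΛ) (B k) * (hubbardTTPrimeFermionInteraction t t' U).localHamiltonian Λ')) =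
        ∑ k ∈ s, (H * Γ' (fermionEmbed (PolySite.incl hΛ) (B k)) - Γ' (fermionEmbed (PolySite.incl hΛ) (B k)) * H) := by
      rw [map_sum]
      refine Finset.sum_congr rfl fun k _ => ?_
      rw [hH, hΓ', hubbardTorusTT'_commutator_fermionEmbed L t t' U hΛ h8 hInj (B k)]
    have h2 : Γ' (∑ l ∈ tt, (fermionEmbed (PolySite.incl (hsh l)) (fermionEmbed (PolySite.shiftEmb (v l) Λ) (Y l)) -
        fermionEmbed (PolySite.incl hΛ) (Y l))) = ∑ l ∈ tt, (Us l * Yt l * (Us l)ᴴ - Yt l) := by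
      rw [map_sum]
      refine Finset.sum_congr rfl fun l _ => ?_
      rw [hUs, hYt, hΓΛ, hΓ']
      exact fermionEmbed_toTorusEmb_shift_sub hΛ (v l) (hsh l) hInj' (Y l)
    have h3 : Γ' (∑ j ∈ u, b j • ladderWord (cw j)) = ∑ j ∈ u, (C j * W j - W j * C j) := by
      rw [map_sum]
      exact Finset.sum_congr rfl hcharged
    have h4 : Γ' (∑ m' ∈ ah, ((dc m' : ℝ) : ℂ) • ((V m')ᴴ - V m')) =
        ∑ m' ∈ ah, ((dc m' : ℝ) : ℂ) • ((Γ' (V m'))ᴴ - Γ' (V m')) := by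
      rw [map_sum]
      refine Finset.sum_congr rfl fun m' _ => ?_
      rw [map_smul, map_sub, hΓ', fermionEmbed_conjTranspose]
    have h5 : Γ' (∑ k ∈ w, a k • ladderWord (word k)) = ∑ k ∈ w, a k • Mw k := by
      rw [map_sum]
      refine Finset.sum_congr rfl fun k _ => ?_
      rw [map_smul, hMw, hΓ', fermionEmbed_ladderWord]
    rw [hX, key, map_add, map_add, map_add, map_add, map_add, hΓ', fermionEmbed_gramForm, ← hΓ', h1, h2, h3, h4, h5,
      Finset.sum_empty, add_zero]
  -- apply the generic torus theorem
  have hA : H.IsHermitian := hubbardTorusTT'_isHermitian L t t' U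
  have hKA : ∀ ψ ∈ (szSector (2 * nh) 0 : Submodule ℂ (Fock (Orb (FermionTorus 2 L)))),
      H *ᵥ ψ ∈ (szSector (2 * nh) 0 : Submodule ℂ (Fock (Orb (FermionTorus 2 L)))) :=
    fun ψ hψ => mulVec_hubbardTorusTT'_mem_szSector L t t' U hψ
  have hAT : ∀ v' : TorusSite 2 L, (fockTranslate v').val * H = H * (fockTranslate v').val := fun v' =>
    (fockTranslate_commute_hubbardTorusTT' L v' t t' U).eq
  have hmain := torus_minEnergyOn_div_ge_of_local_certificate H hA hn hKA hAT X hsum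
    (Finset.univ : Finset (Fin 2)) μ (fun _ => ν) (fun _ => (nh : ℝ)) D G hDsum hGh hGs hΛm
    (fun i => Γ' (O i)) s (fun k => Γ' (fermionEmbed (PolySite.incl hΛ) (B k))) tt Us Yt hU hUK hUK' hUU
    (∅ : Finset (Fin 0)) (fun _ => 0) (fun _ => 0) (fun _ => 0) (fun _ => 0)
    (fun i hi => absurd hi (Finset.notMem_empty i)) (fun i hi => absurd hi (Finset.notMem_empty i))
    u C W hC1 hCK hCK' ah dc (fun m' => Γ' (V m')) w a Mw hMc htorus
  have hs : ∑ σ ∈ (Finset.univ : Finset (Fin 2)), μ σ * ((nh : ℝ) / (L : ℝ) ^ 2 - ν) =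
      (∑ σ : Fin 2, μ σ) * ((nh : ℝ) / (L : ℝ) ^ 2 - ν) := by rw [Finset.sum_mul]
  rw [hs, ← groundEnergy_hubbardTorusTT'_eq_minEnergyOn_szSector L t t' U hn] at hmain
  exact hmain

/-! ### Thermodynamic limit -/

/-- **Window certificate ⇒ thermodynamic-limit energy density of the `t–t'` Hubbard model.** With the
data of `groundEnergy_hubbardTorusTT'_div_ge_of_window_certificate` and target density `n ∈ [0, 2)`
(density constraints `n_{0σ} − (n/2)·1`, `U ≥ 0`), the window identity proves
`c − Σₖ ‖aₖ‖ ≤ energyDensityTT' t t' U n`: the finite-torus bound holds on every large torus along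
`N_L = 2⌊nL²/2⌋` (`x ↦ x mod L` is eventually injective on the window, `exists_forall_le_injOn_proj`)
and passes to the limit by `energyDensityTT'_ge_of_eventually_ge_torus`. Han 2020 §3 (2D Hubbard
model, bootstrap "directly in the thermodynamic limit"); Ruelle 1969 §3.3; Xu et al. 2024 eq. (1).
[cite: Han2020Bootstrap, §3] -/
theorem energyDensityTT'_ge_of_window_certificate (t t' : ℝ) {U : ℝ} (hU : 0 ≤ U) {n : ℝ} (hn0 : 0 ≤ n)
    (hn2 : n < 2)
    {Λ Λ' : Finset (Site 2)} (hΛ : Λ ⊆ Λ') (h8 : thicken Λ 1 ⊆ Λ')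
    (h0 : thicken ({0} : Finset (Site 2)) 1 ⊆ Λ') (hz : (0 : Site 2) ∈ Λ')
    (μ : Fin 2 → ℝ)
    {m : Type*} [Fintype m] [DecidableEq m] {Λm : Matrix m m ℂ} (hΛm : Λm.PosSemidef)
    (O : m → FermionOp Λ')
    {κ : Type*} (s : Finset κ) (B : κ → FermionOp Λ)
    {ι : Type*} (tt : Finset ι) (v : ι → Site 2) (hsh : ∀ l, shiftSet (v l) Λ ⊆ Λ') (Y : ι → FermionOp Λ)
    {γ : Type*} (u : Finset γ) (b : γ → ℂ) (cw : γ → List (Orb (PolySite Λ') × Bool))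
    (hcw : ∀ j ∈ u, ladderCharge (cw j) ≠ 0 ∨ ladderSpinCharge (cw j) ≠ 0)
    {δ : Type*} (ah : Finset δ) (dc : δ → ℝ) (V : δ → FermionOp Λ')
    {κ'' : Type*} (w : Finset κ'') (a : κ'' → ℂ) (word : κ'' → List (Orb (PolySite Λ') × Bool)) {c : ℝ}
    (hcert : fermionEmbed (PolySite.incl h0) ((hubbardTTPrimeFermionInteraction t t' U).meanEnergyObs 1) -
        (c : ℂ) • (1 : FermionOp Λ') -
        ∑ σ : Fin 2, ((μ σ : ℝ) : ℂ) • (nAt 0 hz σ - ((n / 2 : ℝ) : ℂ) • (1 : FermionOp Λ')) =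
      gramForm Λm O +
        (∑ k ∈ s, ((hubbardTTPrimeFermionInteraction t t' U).localHamiltonian Λ' * fermionEmbed (PolySite.incl hΛ) (B k) -
            fermionEmbed (PolySite.incl hΛ) (B k) * (hubbardTTPrimeFermionInteraction t t' U).localHamiltonian Λ') +
          ∑ l ∈ tt, (fermionEmbed (PolySite.incl (hsh l)) (fermionEmbed (PolySite.shiftEmb (v l) Λ) (Y l)) -
            fermionEmbed (PolySite.incl hΛ) (Y l)) +
          ∑ j ∈ u, b j • ladderWord (cw j)) +
        (∑ m' ∈ ah, ((dc m' : ℝ) : ℂ) • ((V m')ᴴ - V m') + ∑ k ∈ w, a k • ladderWord (word k))) :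
    c - ∑ k ∈ w, ‖a k‖ ≤ ThermodynamicLimit.energyDensityTT' t t' U n := by
  obtain ⟨L₀, hL₀⟩ := exists_forall_le_injOn_proj (thicken Λ' 1)
  refine ThermodynamicLimit.energyDensityTT'_ge_of_eventually_ge_torus t t' hU hn0 hn2
    (μ := (∑ σ : Fin 2, μ σ) / 2) ?_
  filter_upwards [Filter.eventually_ge_atTop (max L₀ 3)] with L hL
  have hL3 : 3 ≤ L := le_trans (le_max_right _ _) hL
  have hLL : L₀ ≤ L := le_trans (le_max_left _ _) hL
  haveI : NeZero L := ⟨by omega⟩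
  set nh : ℕ := ⌊n * (L : ℝ) ^ 2 / 2⌋₊ with hnh
  have hrect : ThermodynamicLimit.rectN n L = 2 * nh := rfl
  have hn : nh ≤ Fintype.card (FermionTorus 2 L) := by
    have h := ThermodynamicLimit.rectN_le_two_mul hn0 hn2.le L
    rw [hrect] at h
    have hcard : Fintype.card (FermionTorus 2 L) = L ^ 2 := by simp [FermionTorus]
    rw [hcard, sq]
    omega
  have hmain := groundEnergy_hubbardTorusTT'_div_ge_of_window_certificate t t' U hL3 hn hΛ h8 h0 hz (hL₀ L hLL) μ (n / 2)
    hΛm O s B tt v hsh Y u b cw hcw ah dc V w a word hcert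
  have key : c - ∑ k ∈ w, ‖a k‖ + (∑ σ : Fin 2, μ σ) / 2 * ((((2 * nh : ℕ) : ℝ)) / (L : ℝ) ^ 2 - n) =
      c - ∑ k ∈ w, ‖a k‖ + (∑ σ : Fin 2, μ σ) * ((nh : ℝ) / (L : ℝ) ^ 2 - n / 2) := by
    push_cast
    ring
  rw [hrect, key]
  exact hmain

end Torus

end Literature.MathematicalPhysics.QuantumLattice

end
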